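import Mathlib
import HarnessLib
import Literature.Analysis.Convex.LinearProgrammingDuality

/-!
Superseded duplicate — the mathematics (Schrijver 1986 Cor 7.1e / 7.1g / (35)) lives in
`Literature.Analysis.Convex.LinearProgrammingDuality`; this file keeps the row-form (unbundled-sum)
statements as corollaries.

# Farkas' lemma and linear-programming duality — row-form cross-reference module

Topic `Combinatorics/Optimization`.  Over a linearly ordered field `𝕜` (so in particular over `ℚ`:
exact rational data), for a finite system of linear inequalities written with unbundled sums,
`∑ j, A i j * x j ≤ b i` (rows `i : m`, unknowns `j : n`, both finite index types), this file
records the textbook statements in ROW FORM: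

* `farkas`, `farkas_fin`, `farkas_iff`, `not_exists_le_of_farkasCert`, `farkas_eq` — **Farkas'
  lemma** [Schrijver1986, Cor. 7.1e] as an alternative, as the printed "if and only if", the
  soundness of a Farkas certificate, and the variant with equality rows [Schrijver1986, §7.4 (17)];
* `dotProduct_le_of_dualFeasible`, `isMaxOn_of_certificate`, `isMinOn_of_certificate` — **weak
  duality** and the zero-gap certificate of optimality [Schrijver1986, Cor. 7.1g, first line of the
  proof];
* `exists_primal_dual_eq` — the **Duality theorem of linear programming** [Schrijver1986, Cor. 7.1g];
* `eq_of_optimal`, `gap_eq_sum_mul_slack`, `eq_iff_complementarySlackness` — optimality and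
  **complementary slackness** [Schrijver1986, §7.9 (35)];
* `farkas_mulVec`, `exists_primal_dual_eq_mulVec` — the same in Mathlib's `Matrix` notation.

## This is a cross-reference module, not an independent formalisation

Every result here is the row-form reading of a theorem of
`Literature.Analysis.Convex.LinearProgrammingDuality` (namespace `LPDuality`: `farkas_le` =
Cor. 7.1e, `weak_duality`, `duality` = Cor. 7.1g, `optimal_iff_eq` and
`eq_iff_complementary_slackness` / `complementary_slackness_iff_forall` = §7.9 (35)), obtained by the
definitional conversions `(A *ᵥ x) i = ∑ j, A i j * x j`, `(y ᵥ* A) j = ∑ i, y i * A i j`,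
`y ⬝ᵥ b = ∑ i, y i * b i` and `0 ≤ y ↔ ∀ i, 0 ≤ y i`.  The fourteen public names and their
statements are those of the first (self-contained, Fourier–Motzkin) version of this file and are
kept unchanged; only the proofs were replaced by these corollary derivations.  Two statements have
no counterpart in `LPDuality` and keep short proofs of their own: `farkas_eq` (stacking `E x = d`
as `E x ≤ d, -E x ≤ -d` and applying `farkas`) and `gap_eq_sum_mul_slack` (an algebraic identity).
No novelty is claimed anywhere in this file.

## References

* [Schrijver1986] A. Schrijver, *Theory of Linear and Integer Programming*, Wiley 1986, §7.3
  Cor. 7.1e (Farkas' lemma, variant), §7.4 Cor. 7.1g (Duality theorem of linear programming) and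
  (17), §7.9 (35) (optimality and complementary slackness).
* [DvorakKolmogorov2026] M. Dvořák, V. Kolmogorov, *Duality theory in linear optimization and its
  extensions — formally verified*, Ann. Formaliz. Math. 2 (2026), arXiv:2409.08119 — an independent
  Lean 4 / Mathlib formalisation of Farkas-type alternatives and of strong LP duality in standard
  form (external project, not imported here).
-/

open Finset
open scoped Matrix

namespace Literature.Combinatorics.Optimization

open Literature.Analysis.Convex

variable {𝕜 : Type*} [Field 𝕜] [LinearOrder 𝕜] [IsStrictOrderedRing 𝕜]

section general

variable {m n : Type*} [Fintype m] [Fintype n]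

/-- `farkas` in `Matrix` notation: either `A *ᵥ x ≤ b` is solvable, or some `y ≥ 0` has
`y ᵥ* A = 0` and `y ⬝ᵥ b < 0`.  Corollary of `LPDuality.farkas_le` (Cor. 7.1e) by excluded middle.
[cite: Schrijver1986, Cor. 7.1e] -/
theorem farkas_mulVec (A : Matrix m n 𝕜) (b : m → 𝕜) :
    (∃ x : n → 𝕜, A *ᵥ x ≤ b) ∨ (∃ y : m → 𝕜, 0 ≤ y ∧ y ᵥ* A = 0 ∧ y ⬝ᵥ b < 0) := by
  by_cases h : ∃ x : n → 𝕜, A *ᵥ x ≤ b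
  · exact Or.inl h
  · rw [LPDuality.farkas_le] at h
    push Not at h
    obtain ⟨y, hy, hyA, hyb⟩ := h
    exact Or.inr ⟨y, hy, hyA, hyb⟩

/-- **Farkas' lemma** [Schrijver1986, Cor. 7.1e], alternative form, over any finite index types:
either `A x ≤ b` has a solution, or some `y ≥ 0` has `y A = 0` and `y b < 0`.  Row-form reading of
`farkas_mulVec` / `LPDuality.farkas_le`. [cite: Schrijver1986, Cor. 7.1e] -/
theorem farkas (A : m → n → 𝕜) (b : m → 𝕜) :
    (∃ x : n → 𝕜, ∀ i, ∑ j, A i j * x j ≤ b i) ∨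
    (∃ y : m → 𝕜, (∀ i, 0 ≤ y i) ∧ (∀ j, ∑ i, y i * A i j = 0) ∧ ∑ i, y i * b i < 0) := by
  rcases farkas_mulVec (A : Matrix m n 𝕜) b with ⟨x, hx⟩ | ⟨y, hy, hyA, hyb⟩
  · exact Or.inl ⟨x, fun i => by simpa [Matrix.mulVec, dotProduct] using hx i⟩
  · refine Or.inr ⟨y, fun i => by simpa using hy i, fun j => ?_, by simpa [dotProduct] using hyb⟩
    simpa [Matrix.vecMul, dotProduct] using congrFun hyA j

/-- A **Farkas certificate is sound** (the trivial half of [Schrijver1986, Cor. 7.1e]): `y ≥ 0`,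
`y A = 0` and `y b < 0` exclude every solution of `A x ≤ b`.  This is what an exact-arithmetic
verifier of an LP *infeasibility* certificate checks.  Row-form reading of the forward direction of
`LPDuality.farkas_le`. [cite: Schrijver1986, Cor. 7.1e] -/
theorem not_exists_le_of_farkasCert (A : m → n → 𝕜) (b : m → 𝕜) {y : m → 𝕜}
    (hy : ∀ i, 0 ≤ y i) (hyA : ∀ j, ∑ i, y i * A i j = 0) (hyb : ∑ i, y i * b i < 0) :
    ¬ ∃ x : n → 𝕜, ∀ i, ∑ j, A i j * x j ≤ b i := by
  rintro ⟨x, hx⟩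
  have hx' : ∃ x : n → 𝕜, (A : Matrix m n 𝕜) *ᵥ x ≤ b :=
    ⟨x, fun i => by simpa [Matrix.mulVec, dotProduct] using hx i⟩
  have h0 := (LPDuality.farkas_le (A : Matrix m n 𝕜) b).1 hx' y (fun i => by simpa using hy i)
    (funext fun j => by simpa [Matrix.vecMul, dotProduct] using hyA j)
  have : y ⬝ᵥ b = ∑ i, y i * b i := by simp [dotProduct]
  rw [this] at h0
  exact absurd hyb (not_lt.mpr h0)

/-- **Farkas' lemma**, printed form [Schrijver1986, Cor. 7.1e]: `A x ≤ b` has a solution if and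
only if `y b ≥ 0` for each row vector `y ≥ 0` with `y A = 0`.  Row-form reading of
`LPDuality.farkas_le`. [cite: Schrijver1986, Cor. 7.1e] -/
theorem farkas_iff (A : m → n → 𝕜) (b : m → 𝕜) :
    (∃ x : n → 𝕜, ∀ i, ∑ j, A i j * x j ≤ b i) ↔
      ∀ y : m → 𝕜, (∀ i, 0 ≤ y i) → (∀ j, ∑ i, y i * A i j = 0) → 0 ≤ ∑ i, y i * b i := by
  constructor
  · intro hx y hy hyA
    by_contra h
    exact not_exists_le_of_farkasCert A b hy hyA (lt_of_not_ge h) hx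
  · intro h
    rcases farkas A b with hx | ⟨y, hy, hyA, hyb⟩
    · exact hx
    · exact absurd (h y hy hyA) (not_le.mpr hyb)

/-- **Farkas' lemma with equality rows**: either `A x ≤ b, E x = d` has a solution, or some
`y ≥ 0` and (free) `z` have `y A + z E = 0` and `y b + z d < 0`; by writing `E x = d` as
`E x ≤ d, -E x ≤ -d` [Schrijver1986, §7.4 (17)] and applying `farkas` to the stacked system (no
separate counterpart in `LPDuality`; the stacking is kept here).
[cite: Schrijver1986, Cor. 7.1e and §7.4 (17)] -/
theorem farkas_eq {p : Type*} [Fintype p] (A : m → n → 𝕜) (b : m → 𝕜) (E : p → n → 𝕜)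
    (d : p → 𝕜) :
    (∃ x : n → 𝕜, (∀ i, ∑ j, A i j * x j ≤ b i) ∧ ∀ k, ∑ j, E k j * x j = d k) ∨
    (∃ (y : m → 𝕜) (z : p → 𝕜), (∀ i, 0 ≤ y i) ∧
      (∀ j, ∑ i, y i * A i j + ∑ k, z k * E k j = 0) ∧ ∑ i, y i * b i + ∑ k, z k * d k < 0) := by
  -- the stacked system on rows `m ⊕ (p ⊕ p)`
  set A' : m ⊕ (p ⊕ p) → n → 𝕜 := fun q => match q with
    | Sum.inl i => A i
    | Sum.inr (Sum.inl k) => E k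
    | Sum.inr (Sum.inr k) => fun j => -E k j with hA'
  set b' : m ⊕ (p ⊕ p) → 𝕜 := fun q => match q with
    | Sum.inl i => b i
    | Sum.inr (Sum.inl k) => d k
    | Sum.inr (Sum.inr k) => -d k with hb'
  rcases farkas A' b' with ⟨x, hx⟩ | ⟨y, hy0, hyA, hyb⟩
  · refine Or.inl ⟨x, fun i => hx (Sum.inl i), fun k => le_antisymm (hx (Sum.inr (Sum.inl k))) ?_⟩
    have := hx (Sum.inr (Sum.inr k))
    simp only [hA', hb', neg_mul, Finset.sum_neg_distrib, neg_le_neg_iff] at this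
    exact this
  · refine Or.inr ⟨fun i => y (Sum.inl i), fun k => y (Sum.inr (Sum.inl k)) - y (Sum.inr (Sum.inr k)),
      fun i => hy0 _, fun j => ?_, ?_⟩
    · have := hyA j
      simp only [hA', Fintype.sum_sum_type, mul_neg] at this
      rw [← this]
      simp only [sub_mul, Finset.sum_sub_distrib, Finset.sum_neg_distrib]
      ring
    · simp only [hb', Fintype.sum_sum_type, mul_neg] at hyb
      have e : ∑ k, (y (Sum.inr (Sum.inl k)) - y (Sum.inr (Sum.inr k))) * d k =
          ∑ k, y (Sum.inr (Sum.inl k)) * d k - ∑ k, y (Sum.inr (Sum.inr k)) * d k := by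
        simp only [sub_mul, Finset.sum_sub_distrib]
      rw [e]
      simp only [Finset.sum_neg_distrib] at hyb
      linarith

/-! ### Weak duality and certificates of optimality -/

/-- **Weak duality** (first line of the proof of [Schrijver1986, Cor. 7.1g]): if `y ≥ 0` and
`y A = c` then `c x ≤ y b` for every solution of `A x ≤ b`.  An exact verifier that checks `y ≥ 0`
and `y A = c` has certified the BOUND `max {c x | A x ≤ b} ≤ y b`.  Row-form reading of
`LPDuality.weak_duality`. [cite: Schrijver1986, Cor. 7.1g] -/
theorem dotProduct_le_of_dualFeasible (A : m → n → 𝕜) (b : m → 𝕜) (c : n → 𝕜) {x : n → 𝕜}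
    {y : m → 𝕜} (hx : ∀ i, ∑ j, A i j * x j ≤ b i) (hy : ∀ i, 0 ≤ y i)
    (hyA : ∀ j, ∑ i, y i * A i j = c j) : ∑ j, c j * x j ≤ ∑ i, y i * b i := by
  have h := LPDuality.weak_duality (A := (A : Matrix m n 𝕜)) (b := b) (c := c) (x := x) (y := y)
    (fun i => by simpa [Matrix.mulVec, dotProduct] using hx i) (fun i => by simpa using hy i)
    (funext fun j => by simpa [Matrix.vecMul, dotProduct] using hyA j)
  simpa [dotProduct] using h

/-- **Certificate of optimality, primal side**: a feasible `x` and a dual-feasible `y` with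
`c x = y b` (zero duality gap) prove that `x` is feasible and maximises `c x` over `{x | A x ≤ b}`
(immediate from weak duality). [cite: Schrijver1986, Cor. 7.1g] -/
theorem isMaxOn_of_certificate (A : m → n → 𝕜) (b : m → 𝕜) (c : n → 𝕜) {x : n → 𝕜}
    {y : m → 𝕜} (hx : ∀ i, ∑ j, A i j * x j ≤ b i) (hy : ∀ i, 0 ≤ y i)
    (hyA : ∀ j, ∑ i, y i * A i j = c j) (hgap : ∑ j, c j * x j = ∑ i, y i * b i) :
    x ∈ {x' : n → 𝕜 | ∀ i, ∑ j, A i j * x' j ≤ b i} ∧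
      IsMaxOn (fun x' : n → 𝕜 => ∑ j, c j * x' j) {x' | ∀ i, ∑ j, A i j * x' j ≤ b i} x := by
  refine ⟨hx, fun x' hx' => ?_⟩
  show ∑ j, c j * x' j ≤ ∑ j, c j * x j
  rw [hgap]
  exact dotProduct_le_of_dualFeasible A b c hx' hy hyA

/-- **Certificate of optimality, dual side**: the same data prove that `y` is dual feasible and
minimises `y b` over `{y ≥ 0 | y A = c}` (immediate from weak duality).
[cite: Schrijver1986, Cor. 7.1g] -/
theorem isMinOn_of_certificate (A : m → n → 𝕜) (b : m → 𝕜) (c : n → 𝕜) {x : n → 𝕜}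
    {y : m → 𝕜} (hx : ∀ i, ∑ j, A i j * x j ≤ b i) (hy : ∀ i, 0 ≤ y i)
    (hyA : ∀ j, ∑ i, y i * A i j = c j) (hgap : ∑ j, c j * x j = ∑ i, y i * b i) :
    y ∈ {y' : m → 𝕜 | (∀ i, 0 ≤ y' i) ∧ ∀ j, ∑ i, y' i * A i j = c j} ∧
      IsMinOn (fun y' : m → 𝕜 => ∑ i, y' i * b i)
        {y' | (∀ i, 0 ≤ y' i) ∧ ∀ j, ∑ i, y' i * A i j = c j} y := by
  refine ⟨⟨hy, hyA⟩, ?_⟩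
  rintro y' ⟨hy', hy'A⟩
  show ∑ i, y i * b i ≤ ∑ i, y' i * b i
  rw [← hgap]
  exact dotProduct_le_of_dualFeasible A b c hx hy' hy'A

/-! ### The Duality theorem of linear programming -/

/-- `exists_primal_dual_eq` in `Matrix` notation: `max {c ⬝ᵥ x | A *ᵥ x ≤ b} = min {y ⬝ᵥ b | 0 ≤ y,
y ᵥ* A = c}` when both sides are feasible, with a feasible pair attaining the common value.  This
IS `LPDuality.duality` (Cor. 7.1g). [cite: Schrijver1986, Cor. 7.1g] -/
theorem exists_primal_dual_eq_mulVec (A : Matrix m n 𝕜) (b : m → 𝕜) (c : n → 𝕜)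
    (hP : ∃ x : n → 𝕜, A *ᵥ x ≤ b) (hD : ∃ y : m → 𝕜, 0 ≤ y ∧ y ᵥ* A = c) :
    ∃ (x : n → 𝕜) (y : m → 𝕜), A *ᵥ x ≤ b ∧ 0 ≤ y ∧ y ᵥ* A = c ∧ c ⬝ᵥ x = y ⬝ᵥ b :=
  LPDuality.duality A b c hP hD

/-- **Duality theorem of linear programming** [Schrijver1986, Cor. 7.1g]: if `A x ≤ b` has a
solution and some `y ≥ 0` has `y A = c`, then there are such `x` and `y` with `c x = y b`; hence
`max {c x | A x ≤ b} = min {y b | y ≥ 0, y A = c}` with both optima attained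
(`isMaxOn_of_certificate`, `isMinOn_of_certificate`).  Row-form reading of `LPDuality.duality`.
[cite: Schrijver1986, Cor. 7.1g] -/
theorem exists_primal_dual_eq (A : m → n → 𝕜) (b : m → 𝕜) (c : n → 𝕜)
    (hP : ∃ x : n → 𝕜, ∀ i, ∑ j, A i j * x j ≤ b i)
    (hD : ∃ y : m → 𝕜, (∀ i, 0 ≤ y i) ∧ ∀ j, ∑ i, y i * A i j = c j) :
    ∃ (x : n → 𝕜) (y : m → 𝕜), (∀ i, ∑ j, A i j * x j ≤ b i) ∧ (∀ i, 0 ≤ y i) ∧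
      (∀ j, ∑ i, y i * A i j = c j) ∧ ∑ j, c j * x j = ∑ i, y i * b i := by
  obtain ⟨x₀, hx₀⟩ := hP
  obtain ⟨y₀, hy₀, hy₀A⟩ := hD
  have hP' : ∃ x : n → 𝕜, (A : Matrix m n 𝕜) *ᵥ x ≤ b :=
    ⟨x₀, fun i => by simpa [Matrix.mulVec, dotProduct] using hx₀ i⟩
  have hD' : ∃ y : m → 𝕜, 0 ≤ y ∧ y ᵥ* (A : Matrix m n 𝕜) = c :=
    ⟨y₀, fun i => by simpa using hy₀ i, funext fun j => by
      simpa [Matrix.vecMul, dotProduct] using hy₀A j⟩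
  obtain ⟨x, y, hx, hy, hyA, hgap⟩ := LPDuality.duality (A : Matrix m n 𝕜) b c hP' hD'
  refine ⟨x, y, fun i => by simpa [Matrix.mulVec, dotProduct] using hx i, fun i => by simpa using hy i,
    fun j => by simpa [Matrix.vecMul, dotProduct] using congrFun hyA j,
    by simpa [dotProduct] using hgap⟩

/-! ### Optimality and complementary slackness [Schrijver1986, §7.9 (35)] -/

/-- [Schrijver1986, §7.9 (35) (i) ⇒ (ii)]: if `x₀` maximises `c x` over `{A x ≤ b}` and `y₀`
minimises `y b` over `{y ≥ 0, y A = c}` (both feasible), then `c x₀ = y₀ b`.  Row-form reading of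
the forward direction of `LPDuality.optimal_iff_eq`. [cite: Schrijver1986, §7.9 (35)] -/
theorem eq_of_optimal (A : m → n → 𝕜) (b : m → 𝕜) (c : n → 𝕜) {x₀ : n → 𝕜} {y₀ : m → 𝕜}
    (hx₀ : ∀ i, ∑ j, A i j * x₀ j ≤ b i) (hy₀ : ∀ i, 0 ≤ y₀ i) (hy₀A : ∀ j, ∑ i, y₀ i * A i j = c j)
    (hmax : IsMaxOn (fun x : n → 𝕜 => ∑ j, c j * x j) {x | ∀ i, ∑ j, A i j * x j ≤ b i} x₀)
    (hmin : IsMinOn (fun y : m → 𝕜 => ∑ i, y i * b i)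
      {y | (∀ i, 0 ≤ y i) ∧ ∀ j, ∑ i, y i * A i j = c j} y₀) :
    ∑ j, c j * x₀ j = ∑ i, y₀ i * b i := by
  have hx₀' : (A : Matrix m n 𝕜) *ᵥ x₀ ≤ b :=
    fun i => by simpa [Matrix.mulVec, dotProduct] using hx₀ i
  have hy₀' : (0 : m → 𝕜) ≤ y₀ := fun i => by simpa using hy₀ i
  have hy₀A' : y₀ ᵥ* (A : Matrix m n 𝕜) = c :=
    funext fun j => by simpa [Matrix.vecMul, dotProduct] using hy₀A j
  have h := (LPDuality.optimal_iff_eq hx₀' hy₀' hy₀A').mp ⟨fun x hx => ?_, fun y hy hyA => ?_⟩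
  · simpa [dotProduct] using h
  · have hx' : x ∈ {x | ∀ i, ∑ j, A i j * x j ≤ b i} :=
      fun i => by simpa [Matrix.mulVec, dotProduct] using hx i
    simpa [dotProduct] using hmax hx'
  · have hy' : y ∈ {y | (∀ i, 0 ≤ y i) ∧ ∀ j, ∑ i, y i * A i j = c j} :=
      ⟨fun i => by simpa using hy i, fun j => by simpa [Matrix.vecMul, dotProduct] using congrFun hyA j⟩
    simpa [dotProduct] using hmin hy'

omit [LinearOrder 𝕜] [IsStrictOrderedRing 𝕜] in
/-- The duality gap as a sum of slacks: if `y A = c` then `y b - c x = ∑ i, y i * (b - A x) i`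
(an algebraic identity over any field; kept with its own proof). [cite: Schrijver1986, §7.9 (35)] -/
theorem gap_eq_sum_mul_slack (A : m → n → 𝕜) (b : m → 𝕜) (c : n → 𝕜) (x : n → 𝕜) {y : m → 𝕜}
    (hyA : ∀ j, ∑ i, y i * A i j = c j) :
    ∑ i, y i * b i - ∑ j, c j * x j = ∑ i, y i * (b i - ∑ j, A i j * x j) := by
  have h2 : ∑ i, y i * (∑ j, A i j * x j) = ∑ j, (∑ i, y i * A i j) * x j := by
    simp only [Finset.mul_sum, Finset.sum_mul]
    rw [Finset.sum_comm]
    exact Finset.sum_congr rfl fun j _ => Finset.sum_congr rfl fun i _ => by ring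
  simp only [mul_sub, Finset.sum_sub_distrib, h2, hyA]

/-- **Complementary slackness** [Schrijver1986, §7.9 (35) (ii) ⇔ (iii)]: for a feasible `x` and a
dual-feasible `y`, `c x = y b` if and only if `y i * (b - A x) i = 0` for every row `i` (a row with
`y i > 0` is tight).  Together with feasibility, (iii) is an equivalent check of the optimality
certificate (`isMaxOn_of_certificate`).  Row-form reading of
`LPDuality.eq_iff_complementary_slackness` with `LPDuality.complementary_slackness_iff_forall`.
[cite: Schrijver1986, §7.9 (35)] -/
theorem eq_iff_complementarySlackness (A : m → n → 𝕜) (b : m → 𝕜) (c : n → 𝕜) {x : n → 𝕜}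
    {y : m → 𝕜} (hx : ∀ i, ∑ j, A i j * x j ≤ b i) (hy : ∀ i, 0 ≤ y i)
    (hyA : ∀ j, ∑ i, y i * A i j = c j) :
    ∑ j, c j * x j = ∑ i, y i * b i ↔ ∀ i, y i * (b i - ∑ j, A i j * x j) = 0 := by
  have hx' : (A : Matrix m n 𝕜) *ᵥ x ≤ b :=
    fun i => by simpa [Matrix.mulVec, dotProduct] using hx i
  have hy' : (0 : m → 𝕜) ≤ y := fun i => by simpa using hy i
  have hyA' : y ᵥ* (A : Matrix m n 𝕜) = c :=
    funext fun j => by simpa [Matrix.vecMul, dotProduct] using hyA j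
  have key := (LPDuality.eq_iff_complementary_slackness (b := b) (x₀ := x) hyA').trans
    (LPDuality.complementary_slackness_iff_forall hx' hy')
  have e1 : c ⬝ᵥ x = ∑ j, c j * x j := by simp [dotProduct]
  have e2 : y ⬝ᵥ b = ∑ i, y i * b i := by simp [dotProduct]
  rw [e1, e2] at key
  rw [key]
  refine forall_congr' fun i => ?_
  have e3 : ((A : Matrix m n 𝕜) *ᵥ x) i = ∑ j, A i j * x j := by simp [Matrix.mulVec, dotProduct]
  rw [e3, mul_eq_zero, sub_eq_zero]
  constructor
  · intro h
    rcases eq_or_lt_of_le (hy i) with h0 | hpos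
    · exact Or.inl h0.symm
    · exact Or.inr (h hpos).symm
  · rintro (h0 | htight) hpos
    · exact absurd h0 hpos.ne'
    · exact htight.symm

end general

/-- **Farkas' lemma**, unknowns indexed by `Fin r` (the form in which the first version of this file
ran its Fourier–Motzkin induction): for rows `A a` and right-hand sides `b a` (`a : α`, finite),
either some `x` has `∑ i, A a i * x i ≤ b a` for all `a`, or some `y ≥ 0` has `∑ a, y a * A a i = 0`
for all `i` and `∑ a, y a * b a < 0`.  Now the special case `n = Fin r` of `farkas`.
[cite: Schrijver1986, Cor. 7.1e and §12.2] -/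
theorem farkas_fin : ∀ (r : ℕ) {α : Type*} [Fintype α] (A : α → Fin r → 𝕜) (b : α → 𝕜),
    (∃ x : Fin r → 𝕜, ∀ a, ∑ i, A a i * x i ≤ b a) ∨
    (∃ y : α → 𝕜, (∀ a, 0 ≤ y a) ∧ (∀ i, ∑ a, y a * A a i = 0) ∧ ∑ a, y a * b a < 0) :=
  by
  intro r α _ A b
  exact farkas A b

end Literature.Combinatorics.Optimization
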